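import Mathlib.Algebra.MvPolynomial.Funext
import Mathlib.RingTheory.MvPolynomial.Basic
import Mathlib.RingTheory.Polynomial.Basic
import Literature.Computability.Complexity.NullstellensatzRefutation
import Literature.Computability.MetaComplexity.PolynomialCalculus
import HarnessLib

/-!
# NS refutations are PC refutations; Razborov's `n/2` bound in Nullstellensatz form (THEOREM)

Bridge between `NullstellensatzRefutation.lean` (NS) and
`Literature/Computability/MetaComplexity/PolynomialCalculus.lean` (PC): a Nullstellensatz refutation
`∑_a g_a · A_a = 1` with every product of total degree `≤ d`, all `A_a` among the axioms `𝓕` or the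
Boolean axioms `x_j² - x_j`, IS a degree-`≤ d` PC/F-refutation of `𝓕` (each non-zero product is the
line `A_a · g_a` obtained by the multiplication rule from the axiom `A_a`, whose own degree is at most
that of the product over a field; the sum by the addition rule) — Krajíček 2019, §6.2 ("NS is a
subsystem of PC"). Consequently Razborov's Thm. 16.2.1 (named fact
`PC.Razborov1998_PC_negWPHP_degree`: no degree-`≤ n/2` PC/F-refutation of `¬WPHP^m_n`, `m > n ≥ 1`)
yields, as a THEOREM conditional on that one fact (no new named fact; ledger cite item wi-15693 is
served by the existing one): `¬WPHP^m_n` has no NS/F-refutation of degree `≤ n/2` — in the product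
convention, and in the multiplier convention with `D + 2 ≤ n/2` — for every family of axioms drawn
from `PC.negWPHP F m n` and the Boolean axioms. This is the NS floor wanted by route
MatrixMultiplication/BrentRefutationDepth (item `NSDepthLowerBound`, stmt-MatrixMultiplication-5586).

## References

* J. Krajíček, *Proof Complexity*, CUP 2019, §6.2 (NS ⊆ PC), Thm. 16.2.1, Lemma 16.2.3.
  [KrajicekProofComplexity2019]
* A. A. Razborov, *Lower bounds for the polynomial calculus*, Comput. Complexity 7 (1998), Thm. 1.1.
  [Razborov1998]
-/

noncomputable section

open MvPolynomial Finset

namespace Literature.Computability.Complexity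

open Literature.Computability.MetaComplexity

variable {σ : Type*} {F : Type*} [Field F]

/-- A non-empty sum of degree-`≤ d` PC-derivable polynomials is PC-derivable in degree `≤ d`
(iterated addition rule). [folklore] -/
theorem PC.derivableInDegree_sum {𝓕 : Set (MvPolynomial σ F)} {d : ℕ} {ι : Type*}
    (t : ι → MvPolynomial σ F) {s : Finset ι} (hs : s.Nonempty)
    (h : ∀ a ∈ s, PC.DerivableInDegree 𝓕 d (t a)) :
    PC.DerivableInDegree 𝓕 d (∑ a ∈ s, t a) := by
  classical
  induction hs using Finset.Nonempty.cons_induction with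
  | singleton a => simpa using h a (Finset.mem_singleton_self a)
  | cons a s ha hs ih =>
    rw [Finset.sum_cons]
    exact .add (h a (Finset.mem_cons_self a s)) (ih fun b hb => h b (Finset.mem_cons_of_mem hb))

/-- Over a field, a non-zero product bounds the degree of each factor: if `g * A ≠ 0` then
`A.totalDegree ≤ (g * A).totalDegree`. [folklore] -/
theorem totalDegree_le_of_mul_ne_zero {g A : MvPolynomial σ F} (h : g * A ≠ 0) :
    A.totalDegree ≤ (g * A).totalDegree := by
  have hg : g ≠ 0 := fun hg => h (by simp [hg])
  have hA : A ≠ 0 := fun hA => h (by simp [hA])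
  rw [totalDegree_mul_of_isDomain hg hA]
  exact Nat.le_add_left _ _

/-- **An NS refutation of degree `≤ d` is a degree-`≤ d` PC refutation** (Krajíček 2019, §6.2: NS
is the subsystem of PC whose proofs are the single lines `∑ g_a A_a`): if `∑_a g a · 𝒜 a = 1` with
all products of total degree `≤ d` and every `𝒜 a` is an axiom of `𝓕` or a Boolean axiom, then `1`
has a degree-`≤ d` PC/F-proof from `𝓕`. [cite: KrajicekProofComplexity2019, §6.2] -/
theorem PC.refutableInDegree_of_hasNSRefutationOfDegree {𝓕 : Set (MvPolynomial σ F)} {ι : Type*}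
    {𝒜 : ι → MvPolynomial σ F} {d : ℕ} (h : HasNSRefutationOfDegree 𝒜 d)
    (h𝒜 : ∀ a, 𝒜 a ∈ 𝓕 ∪ Set.range fun j : σ => (X j ^ 2 - X j : MvPolynomial σ F)) :
    PC.RefutableInDegree 𝓕 d := by
  classical
  obtain ⟨s, g, hsum, hdeg⟩ := h
  -- keep only the non-zero products
  set s' := s.filter fun a => g a * 𝒜 a ≠ 0 with hs'
  have hsum' : (∑ a ∈ s', g a * 𝒜 a) = 1 := by
    rw [hs', Finset.sum_filter_ne_zero, hsum]
  have hne : s'.Nonempty := by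
    by_contra hempty
    rw [Finset.not_nonempty_iff_eq_empty] at hempty
    rw [hempty, Finset.sum_empty] at hsum'
    exact zero_ne_one hsum'
  have hterm : ∀ a ∈ s', PC.DerivableInDegree 𝓕 d (g a * 𝒜 a) := by
    intro a ha
    have ha' : a ∈ s ∧ g a * 𝒜 a ≠ 0 := by simpa [hs'] using ha
    have hprod : (g a * 𝒜 a).totalDegree ≤ d := hdeg a ha'.1
    have hAdeg : (𝒜 a).totalDegree ≤ d := (totalDegree_le_of_mul_ne_zero ha'.2).trans hprod
    have hax : PC.DerivableInDegree 𝓕 d (𝒜 a) := by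
      rcases h𝒜 a with hmem | ⟨j, hj⟩
      · exact .hyp hmem hAdeg
      · rw [← hj] at hAdeg ⊢
        exact .booleanAxiom j hAdeg
    have hcomm : g a * 𝒜 a = 𝒜 a * g a := mul_comm _ _
    rw [hcomm] at hprod ⊢
    exact .mul (g a) hax hprod
  have := PC.derivableInDegree_sum (fun a => g a * 𝒜 a) hne hterm
  rw [hsum'] at this
  exact this

/-- **Razborov's bound, Nullstellensatz form (THEOREM from the named fact
`PC.Razborov1998_PC_negWPHP_degree`)**: for every field `F`, `m > n ≥ 1`, and every family of axioms
drawn from `¬WPHP^m_n` (`PC.negWPHP F m n`) and the Boolean axioms, there is no Nullstellensatz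
refutation with all products of degree `≤ n/2` (Krajíček 2019, Thm. 16.2.1 with §6.2; cf. Lemma
16.2.3: for this system PC and NS have the same degree). [cite: KrajicekProofComplexity2019, Thm 16.2.1] -/
theorem not_hasNSRefutationOfDegree_negWPHP (h : PC.Razborov1998_PC_negWPHP_degree)
    (F : Type) [Field F] {m n : ℕ} (hnm : n < m) (hn : 1 ≤ n) {ι : Type*}
    {𝒜 : ι → MvPolynomial (Fin m × Fin n) F}
    (h𝒜 : ∀ a, 𝒜 a ∈ PC.negWPHP F m n ∪
      Set.range fun j : Fin m × Fin n => (X j ^ 2 - X j : MvPolynomial (Fin m × Fin n) F))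
    {d : ℕ} (hd : d ≤ n / 2) : ¬ HasNSRefutationOfDegree 𝒜 d := fun hNS =>
  h F m n hnm hn (PC.DerivableInDegree.mono hd (PC.refutableInDegree_of_hasNSRefutationOfDegree hNS h𝒜))

/-- Multiplier form: no NS refutation of `¬WPHP^m_n` with multipliers of degree `≤ D` when
`D + 2 ≤ n/2` (every axiom of `¬WPHP^m_n` and every Boolean axiom has degree `≤ 2`).
[cite: KrajicekProofComplexity2019, Thm 16.2.1] -/
theorem not_hasNSRefutationWithMultipliersOfDegree_negWPHP (h : PC.Razborov1998_PC_negWPHP_degree)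
    (F : Type) [Field F] {m n : ℕ} (hnm : n < m) (hn : 1 ≤ n) {ι : Type*}
    {𝒜 : ι → MvPolynomial (Fin m × Fin n) F}
    (h𝒜 : ∀ a, 𝒜 a ∈ PC.negWPHP F m n ∪
      Set.range fun j : Fin m × Fin n => (X j ^ 2 - X j : MvPolynomial (Fin m × Fin n) F))
    (hdeg : ∀ a, (𝒜 a).totalDegree ≤ 2) {D : ℕ} (hD : D + 2 ≤ n / 2) :
    ¬ HasNSRefutationWithMultipliersOfDegree 𝒜 D := fun hNS =>
  not_hasNSRefutationOfDegree_negWPHP h F hnm hn h𝒜 hD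
    (hasNSRefutationOfDegree_of_multipliers hNS hdeg)

end Literature.Computability.Complexity
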